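import Summits.HodgeConjecture.CorCM.MumfordTateRankSevenSplitIsogeny
import Summits.HodgeConjecture.CorCM.MumfordTateRankSixNondegenerate
import Literature.AlgebraicGeometry.HodgeTheory.RealSl2BlocksFiniteProducts
import HarnessLib

/-!
# The rung `dim MT(H¹(X)) = 7` with DECOMPOSABLE semisimple Hodge Lie algebra, III: no factor of type IV, condition (D) for
# the two factors, and the Hodge conjecture for the split shapes `B₁^{a+1} × B₂^{b+1}`

COR-CM (cell `pub-hodgecm2`, seat `b27` gen 39, count-neutral lane MT-RANK-SEVEN-SPLIT; theorems only, no definition,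
no NEW named fact; nothing here uses or asserts HC_CM).  Sequel of `CorCM/MumfordTateRankSevenSplitIsogeny`: for a complex
abelian variety `X` whose Hodge Lie algebra is the sum of two commuting three-dimensional ideals,
`X ∼ B₁^{a+1} × B₂^{b+1}` with `B₁ ≁ B₂` non-CM elliptic curves or quaternion surfaces.

* **`exists_shape_and_hodge_of_ideal_pair`** — the shape together with: `X` has NO FACTOR OF TYPE IV (so the centre of
  `Lie Hg(H¹X)` vanishes *because* of the endomorphism algebra, Moonen–Zarhin §1); each `Bᵢ` is STABLY NONDEGENERATE
  (`B•(Bᵢ^{N+1}) = D• ⊗ ℂ`, the rung `dim MT ≤ 6` of gen 38, here `dim MT(H¹Bᵢ) ≤ 4`); **if `dim B₁ = dim B₂ = 1`** (two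
  non-isogenous elliptic curves without complex multiplication) then `X` is STABLY NONDEGENERATE and satisfies the Hodge
  conjecture with all its powers UNCONDITIONALLY (Imai 1976 / Moonen–Zarhin Cor. (3.7): `Hg = SL₂ × SL₂`; the tree's real
  `𝔰𝔩₂`-block machinery `HasRealSl2Blocks.isStablyNondegenerate_powSucc_prod_powSucc`); **in general** (quaternion surface
  factors) the same holds GIVEN ONLY the tree's named fact `Hazama1989_stablyNondegenerate_prod` (Hazama 1989 = Moonen–Zarhin
  Thm. (3.2)(1) = Gordon 7.6.2: products of stably nondegenerate varieties without type IV factors), displayed as an explicit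
  hypothesis exactly as the Markman-conditional rungs of gen 32/38.
* `hasNoTypeIVFactor_of_ideal_pair`, `isStablyNondegenerate_of_ideal_pair_of_hazama`,
  `hodgeConjectureFor_powSucc_of_ideal_pair_of_hazama` — the standalone corollaries.

## References

* [MoonenZarhin1999LowDim] B. Moonen, Yu. Zarhin, *Hodge classes on abelian varieties of low dimension*, Math. Ann.
  315 (1999), §1, §2 condition (D), §3 (3.1), Thm. (3.2)(1), Cor. (3.7).
* [Hazama1989] F. Hazama, *Algebraic cycles on nonsimple abelian varieties*, Duke Math. J. 58 (1989).
* [Gordon1999HodgeAVSurvey] B. B. Gordon, *A survey of the Hodge conjecture for abelian varieties*, Thm. 7.5, 7.6.2.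
* [MumfordAV1970] D. Mumford, *Abelian Varieties* (1970), §19 Cor. 2 (p. 174).
-/

noncomputable section

open scoped TensorProduct
open CategoryTheory CategoryTheory.Limits Module

namespace Summit.HodgeConjecture.CorCM

open Literature.AlgebraicGeometry.Motives
open Literature.AlgebraicGeometry.Motives.AbelianVariety
open Literature.AlgebraicGeometry.Motives.HodgeStructure
open Literature.AlgebraicGeometry.HodgeTheory
open Literature.AlgebraicGeometry.Milne1999 (IsOfCMType)

variable [HodgeTensorFacts.{0, 0}] {X : AbelianVariety ℂ} {n : ℕ}

/-- **A simple complex abelian variety with `dim ≤ 2`, not of CM type, with `dim_ℚ End⁰ = dim²` and centre `ℚ` (a non-CM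
elliptic curve or a quaternion surface) has no factor of type IV, `dim MT(H¹) ≤ 4`, and is STABLY NONDEGENERATE**
(`hasNoTypeIVFactor_of_center_le_bot`; `not_le_endAlg_and_finrank_hodgeLie_le_three_of_factor` and the rung
`isStablyNondegenerate_of_not_isOfCMType_of_mtRank_le_six`). [cite: MoonenZarhin1999LowDim, §1 and §2 (2.1)–(2.5)]
[cite: Gordon1999HodgeAVSurvey, Thm. 7.5] -/
theorem hasNoTypeIVFactor_and_isStablyNondegenerate_of_factor {B : AbelianVariety ℂ} (hBs : B.IsSimple) (hB0 : 0 < B.dim)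
    (hB2 : B.dim ≤ 2) (hBcm : ¬ IsOfCMType B) (hfin : Module.finrank ℚ B.endAlgebra = B.dim ^ 2)
    (hZ : Module.finrank ℚ (Subalgebra.center ℚ B.endAlgebra) = 1) :
    HasNoTypeIVFactor B ∧
      (haveI := BettiUniverse.finite (AbelianVariety.isSmoothProjective_holds (A := B)) 1
       (BettiUniverse.hodge exists_isReal_hodgeModel_holds (AbelianVariety.isSmoothProjective_holds (A := B)) 1).mtRank ≤ 4) ∧
      IsStablyNondegenerate B := by
  haveI := BettiUniverse.finite (AbelianVariety.isSmoothProjective_holds (A := B)) 1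
  haveI : Module.Finite ℚ B.endAlgebra := finiteDimensional_endAlgebra_holds B
  have hA4 : HasNoTypeIVFactor B :=
    hasNoTypeIVFactor_of_center_le_bot (le_of_eq (Subalgebra.eq_bot_of_finrank_one hZ))
  obtain ⟨-, h3⟩ := not_le_endAlg_and_finrank_hodgeLie_le_three_of_factor hBs hB0 hBcm hfin hB2
  have hmt : (BettiUniverse.hodge exists_isReal_hodgeModel_holds (AbelianVariety.isSmoothProjective_holds (A := B)) 1).mtRank
      ≤ 4 := by
    rw [mtRank_hodge_one_eq_finrank_hodgeLie_add_one (AbelianVariety.isSmoothProjective_holds (A := B)) hB0]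
    omega
  exact ⟨hA4, hmt, isStablyNondegenerate_of_not_isOfCMType_of_mtRank_le_six (AbelianVariety.isSmoothProjective_holds (A := B))
    hB0 hBcm (by omega)⟩

/-- **The split shape of the rung `dim MT(H¹X) = 7` with its Hodge-conjecture consequences.**  For a complex abelian variety
`X` whose Hodge Lie algebra is the sum of two commuting three-dimensional ideals `𝔞 ⊕ 𝔟` (neither inside `End_Hdg(H¹X)`):
`X ∼ B₁^{a+1} × B₂^{b+1}` with `B₁`, `B₂` SIMPLE, NOT of CM type, `0 < dim Bᵢ ≤ 2`, `dim End⁰(Bᵢ) = (dim Bᵢ)²`, `Z(End⁰ Bᵢ) = ℚ`,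
`Hom(B₁, B₂) = 0 = Hom(B₂, B₁)`; moreover `X` has NO FACTOR OF TYPE IV, each `Bᵢ` is STABLY NONDEGENERATE; if
`dim B₁ = dim B₂ = 1` then `X` is stably nondegenerate and the Hodge conjecture holds for `X` and all its powers,
UNCONDITIONALLY (Imai / Moonen–Zarhin Cor. (3.7)); and in general the same holds GIVEN ONLY Hazama's product theorem
`Hazama1989_stablyNondegenerate_prod` (explicit hypothesis). [cite: MoonenZarhin1999LowDim, §1, §3 (3.1), Thm. (3.2)(1) and Cor. (3.7)]
[cite: Hazama1989, Thm. (= Gordon 7.6.2)] [cite: Gordon1999HodgeAVSurvey, Thm. 7.5 and 7.6.2] -/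
theorem exists_shape_and_hodge_of_ideal_pair (hX : IsSmoothProjective n X.X)
    {𝔞 𝔟 : Submodule ℚ (Module.End ℚ (bettiCohomology X.X 1))}
    (h𝔞 : haveI := BettiUniverse.finite hX 1
      𝔞 ≤ (BettiUniverse.hodge exists_isReal_hodgeModel_holds hX 1).hodgeLie)
    (h𝔟 : haveI := BettiUniverse.finite hX 1
      𝔟 ≤ (BettiUniverse.hodge exists_isReal_hodgeModel_holds hX 1).hodgeLie)
    (hI𝔞 : haveI := BettiUniverse.finite hX 1
      ∀ W ∈ (BettiUniverse.hodge exists_isReal_hodgeModel_holds hX 1).hodgeLie, ∀ a ∈ 𝔞, W * a - a * W ∈ 𝔞)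
    (hI𝔟 : haveI := BettiUniverse.finite hX 1
      ∀ W ∈ (BettiUniverse.hodge exists_isReal_hodgeModel_holds hX 1).hodgeLie, ∀ b ∈ 𝔟, W * b - b * W ∈ 𝔟)
    (hcomm : ∀ a ∈ 𝔞, ∀ b ∈ 𝔟, a * b = b * a)
    (hsum : haveI := BettiUniverse.finite hX 1
      (BettiUniverse.hodge exists_isReal_hodgeModel_holds hX 1).hodgeLie ≤ 𝔞 ⊔ 𝔟)
    (h3𝔞 : Module.finrank ℚ 𝔞 = 3) (h3𝔟 : Module.finrank ℚ 𝔟 = 3)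
    (hne𝔞 : haveI := BettiUniverse.finite hX 1
      ¬ 𝔞 ≤ Subalgebra.toSubmodule (BettiUniverse.hodge exists_isReal_hodgeModel_holds hX 1).endAlg)
    (hne𝔟 : haveI := BettiUniverse.finite hX 1
      ¬ 𝔟 ≤ Subalgebra.toSubmodule (BettiUniverse.hodge exists_isReal_hodgeModel_holds hX 1).endAlg) :
    ∃ (B₁ B₂ : AbelianVariety ℂ) (a b : ℕ), B₁.IsSimple ∧ B₂.IsSimple ∧ 0 < B₁.dim ∧ B₁.dim ≤ 2 ∧ 0 < B₂.dim ∧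
      B₂.dim ≤ 2 ∧ ¬ IsOfCMType B₁ ∧ ¬ IsOfCMType B₂ ∧
      Module.finrank ℚ B₁.endAlgebra = B₁.dim ^ 2 ∧ Module.finrank ℚ (Subalgebra.center ℚ B₁.endAlgebra) = 1 ∧
      Module.finrank ℚ B₂.endAlgebra = B₂.dim ^ 2 ∧ Module.finrank ℚ (Subalgebra.center ℚ B₂.endAlgebra) = 1 ∧
      (∀ f : B₁ ⟶ B₂, f = 0) ∧ (∀ f : B₂ ⟶ B₁, f = 0) ∧ ¬ IsIsogenous B₁ B₂ ∧
      IsIsogenous X ((B₁.powSucc a).prod (B₂.powSucc b)) ∧ (a + 1) * B₁.dim + (b + 1) * B₂.dim = X.dim ∧ ¬ IsOfCMType X ∧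
      HasNoTypeIVFactor X ∧ IsStablyNondegenerate B₁ ∧ IsStablyNondegenerate B₂ ∧
      (B₁.dim = 1 → B₂.dim = 1 →
        IsStablyNondegenerate X ∧ ∀ N : ℕ, HodgeConjectureFor (X.powSucc N).dim (X.powSucc N).X) ∧
      (Hazama1989_stablyNondegenerate_prod →
        IsStablyNondegenerate X ∧ ∀ N : ℕ, HodgeConjectureFor (X.powSucc N).dim (X.powSucc N).X) := by
  haveI := BettiUniverse.finite hX 1
  obtain ⟨B₁, B₂, a, b, hB₁s, hB₂s, hB₁0, hB₁2, hB₂0, hB₂2, hB₁cm, hB₂cm, hfin₁, hZ₁, hfin₂, hZ₂, h12, h21, hniso, hXB, hdim,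
    -, hcm, -, -⟩ :=
    exists_isIsogenous_powSucc_prod_powSucc_of_ideal_pair hX h𝔞 h𝔟 hI𝔞 hI𝔟 hcomm hsum h3𝔞 h3𝔟 hne𝔞 hne𝔟
  obtain ⟨hA4₁, -, hSN₁⟩ := hasNoTypeIVFactor_and_isStablyNondegenerate_of_factor hB₁s hB₁0 hB₁2 hB₁cm hfin₁ hZ₁
  obtain ⟨hA4₂, -, hSN₂⟩ := hasNoTypeIVFactor_and_isStablyNondegenerate_of_factor hB₂s hB₂0 hB₂2 hB₂cm hfin₂ hZ₂
  have hA4 : HasNoTypeIVFactor X := (hA4₁.powSucc_prod_powSucc hA4₂ a b).of_isIsogenous hXB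
  refine ⟨B₁, B₂, a, b, hB₁s, hB₂s, hB₁0, hB₁2, hB₂0, hB₂2, hB₁cm, hB₂cm, hfin₁, hZ₁, hfin₂, hZ₂, h12, h21, hniso, hXB, hdim,
    hcm, hA4, hSN₁, hSN₂, fun hd₁ hd₂ => ?_, fun hHaz => ?_⟩
  · -- two non-isogenous elliptic curves without complex multiplication: real `𝔰𝔩₂`-blocks
    have hf₁ : Module.finrank ℚ B₁.endAlgebra = 1 := by rw [hfin₁, hd₁]; norm_num
    have hf₂ : Module.finrank ℚ B₂.endAlgebra = 1 := by rw [hfin₂, hd₂]; norm_num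
    have hR₁ := hasRealSl2Blocks_of_finrank_endAlgebra_eq_one B₁ hf₁ hd₁
    have hR₂ := hasRealSl2Blocks_of_finrank_endAlgebra_eq_one B₂ hf₂ hd₂
    have hSN : IsStablyNondegenerate X := (hR₁.isStablyNondegenerate_powSucc_prod_powSucc hR₂ h12 h21 a b).of_isIsogenous hXB
    exact ⟨hSN, hSN.hodgeConjectureFor_powSucc⟩
  · -- general split shape, given Hazama's product theorem
    have hSN : IsStablyNondegenerate X :=
      ((IsStablyNondegenerate.prod_of_hazama hHaz hSN₁ hSN₂ hA4₁ hA4₂).powSucc_prod_powSucc a b).of_isIsogenous hXB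
    exact ⟨hSN, hSN.hodgeConjectureFor_powSucc⟩

/-- **A complex abelian variety whose Hodge Lie algebra is the sum of two commuting three-dimensional ideals has NO FACTOR
OF TYPE IV** (`X ∼ B₁^{a+1} × B₂^{b+1}` with `Z(End⁰ Bᵢ) = ℚ`). [cite: MoonenZarhin1999LowDim, §1 and §3 (3.1)]
[cite: MumfordAV1970, §19 Cor. 2 (p. 174)] -/
theorem hasNoTypeIVFactor_of_ideal_pair (hX : IsSmoothProjective n X.X)
    {𝔞 𝔟 : Submodule ℚ (Module.End ℚ (bettiCohomology X.X 1))}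
    (h𝔞 : haveI := BettiUniverse.finite hX 1
      𝔞 ≤ (BettiUniverse.hodge exists_isReal_hodgeModel_holds hX 1).hodgeLie)
    (h𝔟 : haveI := BettiUniverse.finite hX 1
      𝔟 ≤ (BettiUniverse.hodge exists_isReal_hodgeModel_holds hX 1).hodgeLie)
    (hI𝔞 : haveI := BettiUniverse.finite hX 1
      ∀ W ∈ (BettiUniverse.hodge exists_isReal_hodgeModel_holds hX 1).hodgeLie, ∀ a ∈ 𝔞, W * a - a * W ∈ 𝔞)
    (hI𝔟 : haveI := BettiUniverse.finite hX 1
      ∀ W ∈ (BettiUniverse.hodge exists_isReal_hodgeModel_holds hX 1).hodgeLie, ∀ b ∈ 𝔟, W * b - b * W ∈ 𝔟)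
    (hcomm : ∀ a ∈ 𝔞, ∀ b ∈ 𝔟, a * b = b * a)
    (hsum : haveI := BettiUniverse.finite hX 1
      (BettiUniverse.hodge exists_isReal_hodgeModel_holds hX 1).hodgeLie ≤ 𝔞 ⊔ 𝔟)
    (h3𝔞 : Module.finrank ℚ 𝔞 = 3) (h3𝔟 : Module.finrank ℚ 𝔟 = 3)
    (hne𝔞 : haveI := BettiUniverse.finite hX 1
      ¬ 𝔞 ≤ Subalgebra.toSubmodule (BettiUniverse.hodge exists_isReal_hodgeModel_holds hX 1).endAlg)
    (hne𝔟 : haveI := BettiUniverse.finite hX 1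
      ¬ 𝔟 ≤ Subalgebra.toSubmodule (BettiUniverse.hodge exists_isReal_hodgeModel_holds hX 1).endAlg) :
    HasNoTypeIVFactor X := by
  obtain ⟨-, -, -, -, -, -, -, -, -, -, -, -, -, -, -, -, -, -, -, -, -, -, hA4, -⟩ :=
    exists_shape_and_hodge_of_ideal_pair hX h𝔞 h𝔟 hI𝔞 hI𝔟 hcomm hsum h3𝔞 h3𝔟 hne𝔞 hne𝔟
  exact hA4

/-- **Condition (D) for the split shape of the rung `dim MT(H¹X) = 7`, GIVEN Hazama's product theorem**: for `X` whose Hodge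
Lie algebra is the sum of two commuting three-dimensional ideals, `B•(X^{N+1}) = D•(X^{N+1}) ⊗ ℂ` for every `N` provided
`Hazama1989_stablyNondegenerate_prod` (the only binder; nothing else is assumed). [cite: Hazama1989, Thm. (= Gordon 7.6.2)]
[cite: MoonenZarhin1999LowDim, §3 Thm. (3.2)(1)] -/
theorem isStablyNondegenerate_of_ideal_pair_of_hazama (hHaz : Hazama1989_stablyNondegenerate_prod)
    (hX : IsSmoothProjective n X.X) {𝔞 𝔟 : Submodule ℚ (Module.End ℚ (bettiCohomology X.X 1))}
    (h𝔞 : haveI := BettiUniverse.finite hX 1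
      𝔞 ≤ (BettiUniverse.hodge exists_isReal_hodgeModel_holds hX 1).hodgeLie)
    (h𝔟 : haveI := BettiUniverse.finite hX 1
      𝔟 ≤ (BettiUniverse.hodge exists_isReal_hodgeModel_holds hX 1).hodgeLie)
    (hI𝔞 : haveI := BettiUniverse.finite hX 1
      ∀ W ∈ (BettiUniverse.hodge exists_isReal_hodgeModel_holds hX 1).hodgeLie, ∀ a ∈ 𝔞, W * a - a * W ∈ 𝔞)
    (hI𝔟 : haveI := BettiUniverse.finite hX 1
      ∀ W ∈ (BettiUniverse.hodge exists_isReal_hodgeModel_holds hX 1).hodgeLie, ∀ b ∈ 𝔟, W * b - b * W ∈ 𝔟)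
    (hcomm : ∀ a ∈ 𝔞, ∀ b ∈ 𝔟, a * b = b * a)
    (hsum : haveI := BettiUniverse.finite hX 1
      (BettiUniverse.hodge exists_isReal_hodgeModel_holds hX 1).hodgeLie ≤ 𝔞 ⊔ 𝔟)
    (h3𝔞 : Module.finrank ℚ 𝔞 = 3) (h3𝔟 : Module.finrank ℚ 𝔟 = 3)
    (hne𝔞 : haveI := BettiUniverse.finite hX 1
      ¬ 𝔞 ≤ Subalgebra.toSubmodule (BettiUniverse.hodge exists_isReal_hodgeModel_holds hX 1).endAlg)
    (hne𝔟 : haveI := BettiUniverse.finite hX 1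
      ¬ 𝔟 ≤ Subalgebra.toSubmodule (BettiUniverse.hodge exists_isReal_hodgeModel_holds hX 1).endAlg) :
    IsStablyNondegenerate X ∧ ∀ N : ℕ, HodgeConjectureFor (X.powSucc N).dim (X.powSucc N).X := by
  obtain ⟨-, -, -, -, -, -, -, -, -, -, -, -, -, -, -, -, -, -, -, -, -, -, -, -, -, -, hH⟩ :=
    exists_shape_and_hodge_of_ideal_pair hX h𝔞 h𝔟 hI𝔞 hI𝔟 hcomm hsum h3𝔞 h3𝔟 hne𝔞 hne𝔟
  exact hH hHaz

end Summit.HodgeConjecture.CorCM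

end
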